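import Summits.Ventures.Crystal3D.Theorems.StickyWulffConstantGenericWallFloorGeneralLedger
import Summits.Ventures.Crystal3D.Theorems.StickyWulffConstantCoaxialWallLawExitsPayRestrict
import HarnessLib

/-!
# The two-face slot ledger with RESTRICTED payers — every pair of grains, every non-descending slot

HONEST FRAMING. Part of the venture `Summits/Ventures/Crystal3D` (cell `crystal3d-full`), helper
`--supports` the crux `CoaxialWallLaw` (stmt-Ventures-19481, `route-Ventures-StickyWulffConstant`),
REGISTERED line `WallLedgerF` (planner cf-p1 gen 16), stub `stub_coaxialTwoSlabAdhesion`.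
This is the «co-axial ExitsPay/ledger adapter» of the general-filling port (19481-p1 g3's plan):
lane G's bookkeeping theorem `ledger_ge_faces_add_payers` (`…GenericWallFloorGeneralLedger`) assumes the
two slot sets differ (`hA₁₂`, `hA₂₁`) and STEEP slots; both hypotheses fail for the co-axial cell
(translation pairs have equal slot sets; the riser lines of line F run along IN-PLANE, shallow slots).
Here the payers are attached to RESTRICTED exits of grain 1 only — exits satisfying an arbitrary
predicate `Q` that confines them below a height `c ≤ h + 2R₀ − 4` (`payer_height_lt`,
`…CoaxialWallLawExitsPayRestrict`) — and the slot `u` is only asked to be NON-DESCENDING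
(`0 ≤ ⟪A₁ u, e₃⟫`).  Rung credit only; F-C1 not moved.

**Theorem (`coaxial_ledger_ge_faces_add_payers`).**  In the two-slab cell (`X` `1`-separated in
`{−2R₀ ≤ x₂ ≤ h + 2R₀, lateral ≤ ρ}`, `10 ≤ R₀ ≤ ρ`, clamped samples `P₁ ⊆ Λ₁`, `P₂ ⊆ Λ₂` complete in
their windows, clean outer slivers; NO hypothesis relating the two grains), for every slot `u` with
`0 ≤ ⟪A₁ u, e₃⟫`, every predicate `Q` and height `c` with `c + 4 ≤ h + 2R₀` such that every `Q`-exit of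
grain 1 along `u` has height `< c`:
`Σ_{x ∈ X} (12 − deg x) ≥ 2 φ₁ π ρ² + 2 φ₂ π ρ² + #payers(Q) − (240 √2 π + 3120 (4R₀ + 2)) (1 + h) ρ`,
where `payers(Q)` = unsaturated balls within contact distance `3` of a `Q`-exit (the payer set of
`card_exits_le_restrict`).  Mechanism as in lane G (outer-face vacancies of both samples + one unit per
payer off the rim ≤ `12 − deg`); what changes is WHY a payer never carries an outer vacancy off the rim:
at the top face by HEIGHT (`payer_height_lt`: payers sit below `c + 3 ≤ h + 2R₀ − 1`, top-face vacancies
above it, `high_of_up_vacancy`), at the bottom face by the own-grain location lemma for NON-DESCENDING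
slots (`slot_mem_of_full_shell_bottom_of_nonneg`: a full shell deep in the bottom slab followed by a
non-descending step has all its slots inside the complete sample).

WHAT THIS IS NOT: not the stub — combine with `card_onGrain_exits_below_ge` (sources, any slot, all pairs
`Λ₁ ≠ Λ₂`) and `card_exits_le_restrict` (sinks) to get the co-axial general-filling rung modulo the
twin-capped in-plane exits (next file); F-C1 not moved.
-/

noncomputable section

namespace Summit.Ventures.Crystal3D.Theorems

open Summit.Ventures.Crystal3D Finset
open Literature.MathematicalPhysics.StatisticalMechanics (fccStacking)
open scoped InnerProductSpace

/-- **The grain's own exits along a NON-DESCENDING slot are not born deep in the bottom slab.**  If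
`d ∈ X` with full `A`-shell sits at height `≤ −R₀ − 3` off the rim and `0 ≤ ⟪A u, e₃⟫`, then for every
slot `v` the site `d + A u + A v` carries a ball of `X` (variant of `slot_mem_of_full_shell_bottom`,
which asks `u` to be steep; here the lower height bound comes from the shell ball `d + A v` itself). -/
theorem slot_mem_of_full_shell_bottom_of_nonneg
    (A : EuclideanSpace ℝ (Fin 3) ≃ₗᵢ[ℝ] EuclideanSpace ℝ (Fin 3)) (t : EuclideanSpace ℝ (Fin 3))
    (X P : Finset (EuclideanSpace ℝ (Fin 3))) (R₀ ρ : ℝ) (hR₀ : 3 ≤ R₀) (hρ : R₀ ≤ ρ)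
    (hX : ∀ p ∈ X, ∀ q ∈ X, p ≠ q → 1 ≤ dist p q) (hPX : P ⊆ X)
    (hcell : ∀ p ∈ X, -(2 * R₀) ≤ p 2)
    (hP : ∀ p, p ∈ P ↔ (p ∈ (fun q => A q + t) '' fccStacking 1 (Real.sqrt (2 / 3)) ∧
      -(2 * R₀) ≤ p 2 ∧ p 2 ≤ -R₀ ∧ p 0 ^ 2 + p 1 ^ 2 ≤ ρ ^ 2))
    (hclean : ∀ p ∈ X, p 2 < -(2 * R₀) + 1 → p ∈ (fun q => A q + t) '' fccStacking 1 (Real.sqrt (2 / 3)))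
    {d : EuclideanSpace ℝ (Fin 3)} (hd : d ∈ X) (hfull : ∀ w ∈ fccSlots, d + A w ∈ X) (hd2 : d 2 ≤ -R₀ - 3)
    (hdr : d 0 ^ 2 + d 1 ^ 2 ≤ (ρ - 2) ^ 2) {u v : EuclideanSpace ℝ (Fin 3)} (hu : u ∈ fccSlots)
    (hup : 0 ≤ ⟪A u, EuclideanSpace.single (2 : Fin 3) (1 : ℝ)⟫_ℝ) (hv : v ∈ fccSlots) :
    d + A u + A v ∈ X := by
  have hρ2 : (0 : ℝ) ≤ ρ - 2 := by linarith
  have hdP : d ∈ P := mem_sample_bottom_of_deep A t X P R₀ ρ hR₀ hρ hX hPX hcell hP hclean hd (by linarith)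
    (by nlinarith)
  have hdΛ := ((hP d).1 hdP).1
  -- lower bound: the shell ball `d + A v` stays in the cell
  have hlow : -(2 * R₀) ≤ d 2 + ⟪A v, EuclideanSpace.single (2 : Fin 3) (1 : ℝ)⟫_ℝ := by
    have hmem := hfull v hv
    have h2 : (d + A v) 2 = d 2 + ⟪A v, EuclideanSpace.single (2 : Fin 3) (1 : ℝ)⟫_ℝ := by
      rw [PiLp.add_apply, apply_two_eq_inner_e₃ (A v)]
    have := hcell _ hmem
    rwa [h2] at this
  have hαu := abs_le.1 (abs_inner_slot_le_one A hu)
  have hαv := abs_le.1 (abs_inner_slot_le_one A hv)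
  have h2 : (d + A u + A v) 2 = d 2 + ⟪A u, EuclideanSpace.single (2 : Fin 3) (1 : ℝ)⟫_ℝ +
      ⟪A v, EuclideanSpace.single (2 : Fin 3) (1 : ℝ)⟫_ℝ := by
    rw [PiLp.add_apply, PiLp.add_apply, apply_two_eq_inner_e₃ (A u), apply_two_eq_inner_e₃ (A v)]
  have hlat : (d + A u + A v) 0 ^ 2 + (d + A u + A v) 1 ^ 2 ≤ ρ ^ 2 := by
    have h1 := lateral_sq_add_le d (A u) hρ2 hdr
    rw [LinearIsometryEquiv.norm_map, norm_eq_one_of_mem_fccSlots hu, show ρ - 2 + 1 = ρ - 1 by ring] at h1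
    have h3 := lateral_sq_add_le (d + A u) (A v) (by linarith) h1
    rw [LinearIsometryEquiv.norm_map, norm_eq_one_of_mem_fccSlots hv, show ρ - 1 + 1 = ρ by ring] at h3
    exact h3
  refine hPX ((hP _).2 ⟨?_, by rw [h2]; linarith, by rw [h2]; linarith, hlat⟩)
  exact movedFcc_add_site_mem A t (movedFcc_add_site_mem A t hdΛ (mem_fcc_of_mem_fccSlots hu))
    (mem_fcc_of_mem_fccSlots hv)

/-- **No own-grain exit along a non-descending slot within three of a bottom-layer ball.**  If
`y₂ < −2R₀ + 1`, `y` off the rim, `dist e y ≤ 3`, `e − A u ∈ X` with full `A`-shell, `0 ≤ ⟪A u, e₃⟫`,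
then every slot of `e` is occupied. -/
theorem slots_full_of_near_bottom_layer_of_nonneg
    (A : EuclideanSpace ℝ (Fin 3) ≃ₗᵢ[ℝ] EuclideanSpace ℝ (Fin 3)) (t : EuclideanSpace ℝ (Fin 3))
    (X P : Finset (EuclideanSpace ℝ (Fin 3))) (R₀ ρ : ℝ) (hR₀ : 8 ≤ R₀) (hρ : R₀ ≤ ρ)
    (hX : ∀ p ∈ X, ∀ q ∈ X, p ≠ q → 1 ≤ dist p q) (hPX : P ⊆ X)
    (hcell : ∀ p ∈ X, -(2 * R₀) ≤ p 2)
    (hP : ∀ p, p ∈ P ↔ (p ∈ (fun q => A q + t) '' fccStacking 1 (Real.sqrt (2 / 3)) ∧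
      -(2 * R₀) ≤ p 2 ∧ p 2 ≤ -R₀ ∧ p 0 ^ 2 + p 1 ^ 2 ≤ ρ ^ 2))
    (hclean : ∀ p ∈ X, p 2 < -(2 * R₀) + 1 → p ∈ (fun q => A q + t) '' fccStacking 1 (Real.sqrt (2 / 3)))
    {u : EuclideanSpace ℝ (Fin 3)} (hu : u ∈ fccSlots)
    (hup : 0 ≤ ⟪A u, EuclideanSpace.single (2 : Fin 3) (1 : ℝ)⟫_ℝ)
    {e y : EuclideanSpace ℝ (Fin 3)} (hd : e - A u ∈ X) (hfull : ∀ w ∈ fccSlots, e - A u + A w ∈ X)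
    (hylow : y 2 < -(2 * R₀) + 1) (hyr : y 0 ^ 2 + y 1 ^ 2 ≤ (ρ - 8) ^ 2) (hdist : dist e y ≤ 3)
    {v : EuclideanSpace ℝ (Fin 3)} (hv : v ∈ fccSlots) : e + A v ∈ X := by
  have hAu : ‖A u‖ = 1 := by rw [LinearIsometryEquiv.norm_map, norm_eq_one_of_mem_fccSlots hu]
  obtain ⟨hlat, hz, -⟩ := pred_near (by linarith) hdist hAu hyr
  have hmem := slot_mem_of_full_shell_bottom_of_nonneg A t X P R₀ ρ (by linarith) hρ hX hPX hcell hP hclean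
    hd hfull (by linarith) hlat hu hup hv
  rwa [sub_add_cancel] at hmem

open scoped Classical in
/-- **The two-face ledger with restricted payers (every pair of grains).**  See the module docstring. -/
theorem coaxial_ledger_ge_faces_add_payers
    (A₁ : EuclideanSpace ℝ (Fin 3) ≃ₗᵢ[ℝ] EuclideanSpace ℝ (Fin 3)) (t₁ : EuclideanSpace ℝ (Fin 3))
    (A₂ : EuclideanSpace ℝ (Fin 3) ≃ₗᵢ[ℝ] EuclideanSpace ℝ (Fin 3)) (t₂ : EuclideanSpace ℝ (Fin 3))
    (X P₁ P₂ : Finset (EuclideanSpace ℝ (Fin 3))) (R₀ h ρ : ℝ) (hR₀ : 10 ≤ R₀) (hh : 0 ≤ h) (hρ : R₀ ≤ ρ)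
    (hX : ∀ p ∈ X, ∀ q ∈ X, p ≠ q → 1 ≤ dist p q)
    (hcell : ∀ p ∈ X, -(2 * R₀) ≤ p 2 ∧ p 2 ≤ h + 2 * R₀ ∧ p 0 ^ 2 + p 1 ^ 2 ≤ ρ ^ 2)
    (hP₁X : P₁ ⊆ X) (hP₂X : P₂ ⊆ X)
    (hP₁ : ∀ p, p ∈ P₁ ↔ (p ∈ (fun q => A₁ q + t₁) '' fccStacking 1 (Real.sqrt (2 / 3)) ∧
      -(2 * R₀) ≤ p 2 ∧ p 2 ≤ -R₀ ∧ p 0 ^ 2 + p 1 ^ 2 ≤ ρ ^ 2))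
    (hP₂ : ∀ p, p ∈ P₂ ↔ (p ∈ (fun q => A₂ q + t₂) '' fccStacking 1 (Real.sqrt (2 / 3)) ∧
      h + R₀ ≤ p 2 ∧ p 2 ≤ h + 2 * R₀ ∧ p 0 ^ 2 + p 1 ^ 2 ≤ ρ ^ 2))
    (hclean₁ : ∀ p ∈ X, p 2 < -(2 * R₀) + 1 → p ∈ (fun q => A₁ q + t₁) '' fccStacking 1 (Real.sqrt (2 / 3)))
    (hclean₂ : ∀ p ∈ X, h + 2 * R₀ - 1 < p 2 → p ∈ (fun q => A₂ q + t₂) '' fccStacking 1 (Real.sqrt (2 / 3)))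
    {u : EuclideanSpace ℝ (Fin 3)} (hu : u ∈ fccSlots)
    (hup : 0 ≤ ⟪A₁ u, EuclideanSpace.single (2 : Fin 3) (1 : ℝ)⟫_ℝ)
    (Q : EuclideanSpace ℝ (Fin 3) → Prop) (c : ℝ) (hc : c + 4 ≤ h + 2 * R₀)
    (hQ : ∀ e ∈ X, Q e → e - A₁ u ∈ X → (∀ w ∈ fccSlots, e - A₁ u + A₁ w ∈ X) → e 2 < c) :
    2 * (Real.sqrt 2 / 4 * ∑ w ∈ fccSlots, |⟪A₁ w, EuclideanSpace.single (2 : Fin 3) (1 : ℝ)⟫_ℝ|) *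
        Real.pi * ρ ^ 2 +
      2 * (Real.sqrt 2 / 4 * ∑ w ∈ fccSlots, |⟪A₂ w, EuclideanSpace.single (2 : Fin 3) (1 : ℝ)⟫_ℝ|) *
        Real.pi * ρ ^ 2 +
      (((X.filter fun y => (X.filter fun q => dist y q = 1).card ≠ 12 ∧
          ∃ e ∈ X, (Q e ∧ e - A₁ u ∈ X ∧ (∀ w ∈ fccSlots, e - A₁ u + A₁ w ∈ X) ∧
              ∃ v ∈ fccSlots, e + A₁ v ∉ X) ∧
            (y = e ∨ dist e y = 1 ∨ (∃ z ∈ X, dist e z = 1 ∧ dist z y = 1) ∨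
              ∃ z ∈ X, ∃ z' ∈ X, dist e z = 1 ∧ dist z z' = 1 ∧ dist z' y = 1)).card : ℕ) : ℝ) -
      (240 * Real.sqrt 2 * Real.pi + 3120 * (4 * R₀ + 2)) * (1 + h) * ρ ≤
      ∑ x ∈ X, ((12 : ℝ) - ((X.filter fun q => dist x q = 1).card : ℝ)) := by
  set e₃ : EuclideanSpace ℝ (Fin 3) := EuclideanSpace.single (2 : Fin 3) (1 : ℝ) with he₃
  set Λ₁ : Set (EuclideanSpace ℝ (Fin 3)) := (fun q => A₁ q + t₁) '' fccStacking 1 (Real.sqrt (2 / 3)) with hΛ₁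
  set Λ₂ : Set (EuclideanSpace ℝ (Fin 3)) := (fun q => A₂ q + t₂) '' fccStacking 1 (Real.sqrt (2 / 3)) with hΛ₂
  set Down₁ : Finset (EuclideanSpace ℝ (Fin 3)) := fccSlots.filter (fun w => ⟪A₁ w, e₃⟫_ℝ < 0) with hDown₁
  set Up₂ : Finset (EuclideanSpace ℝ (Fin 3)) := fccSlots.filter (fun w => 0 < ⟪A₂ w, e₃⟫_ℝ) with hUp₂
  set O₁ : EuclideanSpace ℝ (Fin 3) → Finset (EuclideanSpace ℝ (Fin 3)) :=
    fun w => P₁.filter (fun p => p + A₁ w ∉ P₁) with hO₁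
  set O₂ : EuclideanSpace ℝ (Fin 3) → Finset (EuclideanSpace ℝ (Fin 3)) :=
    fun w => P₂.filter (fun p => p + A₂ w ∉ P₂) with hO₂
  set W3 : EuclideanSpace ℝ (Fin 3) → EuclideanSpace ℝ (Fin 3) → Prop := fun e y =>
    y = e ∨ dist e y = 1 ∨ (∃ z ∈ X, dist e z = 1 ∧ dist z y = 1) ∨
      ∃ z ∈ X, ∃ z' ∈ X, dist e z = 1 ∧ dist z z' = 1 ∧ dist z' y = 1 with hW3
  set EX₁ : EuclideanSpace ℝ (Fin 3) → Prop := fun e =>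
    Q e ∧ e - A₁ u ∈ X ∧ (∀ w ∈ fccSlots, e - A₁ u + A₁ w ∈ X) ∧ ∃ v ∈ fccSlots, e + A₁ v ∉ X with hEX₁
  set deg : EuclideanSpace ℝ (Fin 3) → ℕ := fun x => (X.filter fun q => dist x q = 1).card with hdeg
  set PAY : Finset (EuclideanSpace ℝ (Fin 3)) := X.filter fun y => deg y ≠ 12 ∧
    (∃ e ∈ X, EX₁ e ∧ W3 e y) with hPAY
  set o₁ : EuclideanSpace ℝ (Fin 3) → ℕ := fun x => (Down₁.filter fun w => x ∈ O₁ w).card with ho₁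
  set o₂ : EuclideanSpace ℝ (Fin 3) → ℕ := fun x => (Up₂.filter fun w => x ∈ O₂ w).card with ho₂
  set PAY' : Finset (EuclideanSpace ℝ (Fin 3)) := PAY.filter fun y => o₁ y = 0 ∧ o₂ y = 0 with hPAY'
  set k : EuclideanSpace ℝ (Fin 3) → ℕ := fun x => o₁ x + o₂ x + (if x ∈ PAY' then 1 else 0) with hk
  set Rim : Finset (EuclideanSpace ℝ (Fin 3)) := X.filter fun x => (ρ - 8) ^ 2 < x 0 ^ 2 + x 1 ^ 2 with hRim
  have hR₀3 : (3 : ℝ) ≤ R₀ := by linarith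
  have hρ0 : (0 : ℝ) ≤ ρ := by linarith
  have hPAYX : PAY ⊆ X := filter_subset _ _
  have hPAY'X : PAY' ⊆ X := (filter_subset _ _).trans hPAYX
  -- (1) face counts
  have hOut₁ := outerCredits_ge A₁ t₁ P₁ R₀ ρ hR₀3 hρ hP₁
  have hOut₂ := outerCredits_ge_top A₂ t₂ P₂ R₀ h ρ hR₀3 hρ hP₂
  -- (2) the sum of the credits
  have hk_sum : ∑ x ∈ X, (k x : ℝ) = ∑ w ∈ Down₁, ((O₁ w).card : ℝ) + ∑ w ∈ Up₂, ((O₂ w).card : ℝ) +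
      (PAY'.card : ℝ) := by
    have hN1 : ∑ x ∈ X, o₁ x = ∑ w ∈ Down₁, (O₁ w).card := by
      simp only [ho₁]
      rw [Finset.sum_congr rfl (fun x _ => Finset.card_filter (fun w => x ∈ O₁ w) Down₁), Finset.sum_comm]
      refine sum_congr rfl fun w _ => ?_
      rw [← Finset.card_filter, filter_mem_eq_inter, inter_eq_right.2 ((filter_subset _ _).trans hP₁X)]
    have hN2 : ∑ x ∈ X, o₂ x = ∑ w ∈ Up₂, (O₂ w).card := by
      simp only [ho₂]
      rw [Finset.sum_congr rfl (fun x _ => Finset.card_filter (fun w => x ∈ O₂ w) Up₂), Finset.sum_comm]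
      refine sum_congr rfl fun w _ => ?_
      rw [← Finset.card_filter, filter_mem_eq_inter, inter_eq_right.2 ((filter_subset _ _).trans hP₂X)]
    have hN3 : ∑ x ∈ X, (if x ∈ PAY' then 1 else 0) = PAY'.card := by
      rw [← Finset.card_filter, filter_mem_eq_inter, inter_eq_right.2 hPAY'X]
    have hN : ∑ x ∈ X, k x = ∑ w ∈ Down₁, (O₁ w).card + ∑ w ∈ Up₂, (O₂ w).card + PAY'.card := by
      simp only [hk, sum_add_distrib, hN1, hN2, hN3]
    have := congrArg (Nat.cast : ℕ → ℝ) hN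
    push_cast at this
    exact this
  -- (3) per-ball facts
  have hdeg12 : ∀ x, deg x ≤ 12 := fun x => card_filter_dist_eq_one_le_twelve X hX x
  have ho₁le : ∀ x, o₁ x ≤ 12 := fun x =>
    (card_filter_le _ _).trans ((card_filter_le _ _).trans (by rw [card_fccSlots]))
  have ho₂le : ∀ x, o₂ x ≤ 12 := fun x =>
    (card_filter_le _ _).trans ((card_filter_le _ _).trans (by rw [card_fccSlots]))
  have hk25 : ∀ x, k x ≤ 25 := by
    intro x
    have h3 : (if x ∈ PAY' then 1 else 0) ≤ 1 := by split_ifs <;> norm_num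
    have := ho₁le x; have := ho₂le x
    simp only [hk]; omega
  -- o₁ x > 0 ⇒ x ∈ P₁ with an outer vacancy
  have ho₁pos : ∀ x, o₁ x ≠ 0 → x ∈ P₁ ∧ ∃ w ∈ Down₁, x + A₁ w ∉ P₁ := by
    intro x hx
    obtain ⟨w, hw⟩ := Finset.card_pos.1 (Nat.pos_of_ne_zero hx)
    rw [mem_filter] at hw
    obtain ⟨hwD, hxO⟩ := hw
    rw [hO₁, mem_filter] at hxO
    exact ⟨hxO.1, w, hwD, hxO.2⟩
  have ho₂pos : ∀ x, o₂ x ≠ 0 → x ∈ P₂ ∧ ∃ w ∈ Up₂, x + A₂ w ∉ P₂ := by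
    intro x hx
    obtain ⟨w, hw⟩ := Finset.card_pos.1 (Nat.pos_of_ne_zero hx)
    rw [mem_filter] at hw
    obtain ⟨hwU, hxO⟩ := hw
    rw [hO₂, mem_filter] at hxO
    exact ⟨hxO.1, w, hwU, hxO.2⟩
  -- a ball is in at most one sample
  have hP₁P₂ : ∀ x, x ∈ P₁ → x ∉ P₂ := by
    intro x h1 h2
    have a := ((hP₁ x).1 h1).2.2.1
    have b := ((hP₂ x).1 h2).2.1
    linarith
  have hk_le : ∀ x ∈ X, ¬ ((ρ - 8) ^ 2 < x 0 ^ 2 + x 1 ^ 2) → (k x : ℝ) ≤ 12 - (deg x : ℝ) := by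
    intro x hx hrim
    push Not at hrim
    have hrim2 : x 0 ^ 2 + x 1 ^ 2 ≤ (ρ - 2) ^ 2 := by nlinarith
    by_cases h1 : o₁ x ≠ 0
    · -- outer vacancy of the bottom sample: no foreign contact, all credited slots empty
      obtain ⟨hxP, w₀, hw₀, hxw₀⟩ := ho₁pos x h1
      have hxΛ : x ∈ Λ₁ := ((hP₁ x).1 hxP).1
      have hnofor : (X.filter fun q => dist x q = 1 ∧ q ∉ Λ₁).card = 0 := by
        rw [Finset.card_eq_zero, Finset.eq_empty_iff_forall_notMem]
        intro q hq
        rw [mem_filter] at hq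
        obtain ⟨hqX, hxq, hqΛ⟩ := hq
        have hw₀' := (mem_filter.1 hw₀)
        exact hxw₀ (not_outerCredit_of_foreign A₁ t₁ X P₁ R₀ ρ hR₀3 hρ hX hP₁X hP₁ hclean₁ hxP hrim2 hqX
          hqΛ hxq hw₀'.1 hw₀'.2.le)
      have hled := twelve_sub_degree_eq A₁ t₁ x X hxΛ
      rw [hnofor] at hled
      have hsub : (Down₁.filter fun w => x ∈ O₁ w) ⊆ fccSlots.filter fun w => x + A₁ w ∉ X := by
        intro w hw
        rw [mem_filter] at hw ⊢
        obtain ⟨hwD, hxO⟩ := hw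
        have hwD' := mem_filter.1 hwD
        rw [hO₁, mem_filter] at hxO
        exact ⟨hwD'.1, outerSlot_not_mem A₁ t₁ X P₁ R₀ h ρ hcell hP₁ (mem_fcc_of_mem_fccSlots hwD'.1)
          hwD'.2.le hxO.1 hxO.2⟩
      have ho₁x : o₁ x ≤ (fccSlots.filter fun w => x + A₁ w ∉ X).card := card_le_card hsub
      have ho₂x : o₂ x = 0 := by
        by_contra h2
        exact hP₁P₂ x hxP (ho₂pos x h2).1
      have hind : (if x ∈ PAY' then 1 else 0) = 0 := by
        rw [if_neg]
        intro hmem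
        rw [hPAY', mem_filter] at hmem
        exact h1 hmem.2.1
      have hkx : k x = o₁ x := by simp only [hk, ho₂x, hind, add_zero]
      rw [hkx]
      have h3 : ((o₁ x : ℕ) : ℤ) ≤ 12 - ((deg x : ℕ) : ℤ) := by
        have := hled; simp only [hdeg]; omega
      have h4 : ((o₁ x : ℕ) : ℝ) ≤ ((12 - ((deg x : ℕ) : ℤ) : ℤ) : ℝ) := by exact_mod_cast h3
      push_cast at h4
      exact h4
    · push Not at h1
      by_cases h2 : o₂ x ≠ 0
      · obtain ⟨hxP, w₀, hw₀, hxw₀⟩ := ho₂pos x h2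
        have hxΛ : x ∈ Λ₂ := ((hP₂ x).1 hxP).1
        have hnofor : (X.filter fun q => dist x q = 1 ∧ q ∉ Λ₂).card = 0 := by
          rw [Finset.card_eq_zero, Finset.eq_empty_iff_forall_notMem]
          intro q hq
          rw [mem_filter] at hq
          obtain ⟨hqX, hxq, hqΛ⟩ := hq
          have hw₀' := (mem_filter.1 hw₀)
          exact hxw₀ (not_outerCredit_of_foreign_top A₂ t₂ X P₂ R₀ h ρ hR₀3 hρ hX hP₂X hP₂ hclean₂ hxP hrim2
            hqX hqΛ hxq hw₀'.1 hw₀'.2.le)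
        have hled := twelve_sub_degree_eq A₂ t₂ x X hxΛ
        rw [hnofor] at hled
        have hsub : (Up₂.filter fun w => x ∈ O₂ w) ⊆ fccSlots.filter fun w => x + A₂ w ∉ X := by
          intro w hw
          rw [mem_filter] at hw ⊢
          obtain ⟨hwU, hxO⟩ := hw
          have hwU' := mem_filter.1 hwU
          rw [hO₂, mem_filter] at hxO
          exact ⟨hwU'.1, outerSlot_not_mem_top A₂ t₂ X P₂ R₀ h ρ hcell hP₂ (mem_fcc_of_mem_fccSlots hwU'.1)
            hwU'.2.le hxO.1 hxO.2⟩
        have ho₂x : o₂ x ≤ (fccSlots.filter fun w => x + A₂ w ∉ X).card := card_le_card hsub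
        have hind : (if x ∈ PAY' then 1 else 0) = 0 := by
          rw [if_neg]
          intro hmem
          rw [hPAY', mem_filter] at hmem
          exact h2 hmem.2.2
        have hkx : k x = o₂ x := by simp only [hk, h1, hind, zero_add, add_zero]
        rw [hkx]
        have h3 : ((o₂ x : ℕ) : ℤ) ≤ 12 - ((deg x : ℕ) : ℤ) := by
          have := hled; simp only [hdeg]; omega
        have h4 : ((o₂ x : ℕ) : ℝ) ≤ ((12 - ((deg x : ℕ) : ℤ) : ℤ) : ℝ) := by exact_mod_cast h3
        push_cast at h4
        exact h4
      · push Not at h2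
        have hkx : k x = (if x ∈ PAY' then 1 else 0) := by simp only [hk, h1, h2, zero_add]
        rw [hkx]
        split_ifs with hmem
        · have hne : deg x ≠ 12 := (mem_filter.1 (mem_filter.1 hmem).1).2.1
          have hle := hdeg12 x
          have : (deg x : ℝ) ≤ 11 := by exact_mod_cast (by omega : deg x ≤ 11)
          push_cast; linarith
        · have : (deg x : ℝ) ≤ 12 := by exact_mod_cast hdeg12 x
          push_cast; linarith
  -- (4) payers with an outer vacancy are rim balls
  have hR₀8 : (8 : ℝ) ≤ R₀ := by linarith
  have hcellz : ∀ p ∈ X, -(2 * R₀) ≤ p 2 := fun p hp => (hcell p hp).1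
  have hfar : ∀ y ∈ PAY, y ∉ PAY' → (ρ - 8) ^ 2 < y 0 ^ 2 + y 1 ^ 2 := by
    intro y hy hy'
    by_contra hrim
    push Not at hrim
    have hcase : o₁ y ≠ 0 ∨ o₂ y ≠ 0 := by
      by_contra hboth
      push Not at hboth
      exact hy' (mem_filter.2 ⟨hy, hboth.1, hboth.2⟩)
    obtain ⟨hyX, -, hex⟩ := mem_filter.1 hy
    rcases hcase with h1 | h2
    · -- bottom face: the own-grain location lemma for non-descending slots
      obtain ⟨hyP, w₀, hw₀, hyw₀⟩ := ho₁pos y h1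
      have hw₀' := mem_filter.1 hw₀
      have hylow := low_of_down_vacancy A₁ t₁ P₁ R₀ ρ (by linarith) hP₁ hyP hw₀'.1 hw₀'.2 hyw₀ hrim
      obtain ⟨e, -, ⟨-, hd, hfull, v, hv, hev⟩, hw⟩ := hex
      exact hev (slots_full_of_near_bottom_layer_of_nonneg A₁ t₁ X P₁ R₀ ρ hR₀8 hρ hX hP₁X hcellz hP₁ hclean₁
        hu hup hd hfull hylow hrim (dist_le_three_of_withinThree hw) hv)
    · -- top face: by height
      obtain ⟨hyP, w₀, hw₀, hyw₀⟩ := ho₂pos y h2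
      have hw₀' := mem_filter.1 hw₀
      have hyhigh := high_of_up_vacancy A₂ t₂ P₂ R₀ h ρ (by linarith) hP₂ hyP hw₀'.1 hw₀'.2 hyw₀ hrim
      have hylt : y 2 < c + 3 := payer_height_lt A₁ Q c hQ hex
      linarith
  have hPAY'ge : (PAY.card : ℝ) - (Rim.card : ℝ) ≤ (PAY'.card : ℝ) := by
    have hsub : PAY \ PAY' ⊆ Rim := by
      intro y hy
      rw [mem_sdiff] at hy
      rw [hRim, mem_filter]
      exact ⟨hPAYX hy.1, hfar y hy.1 hy.2⟩
    have h1 : (PAY \ PAY').card ≤ Rim.card := card_le_card hsub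
    have h2 : PAY.card ≤ (PAY \ PAY').card + PAY'.card := by
      have := Finset.card_sdiff_add_card_inter PAY PAY'
      have : (PAY ∩ PAY').card ≤ PAY'.card := card_le_card inter_subset_right
      omega
    have : (PAY.card : ℝ) ≤ ((PAY \ PAY').card : ℝ) + (PAY'.card : ℝ) := by exact_mod_cast h2
    have : ((PAY \ PAY').card : ℝ) ≤ (Rim.card : ℝ) := by exact_mod_cast h1
    linarith
  -- (5) the rim count
  have hRim : (Rim.card : ℝ) ≤ 120 * (4 * R₀ + 2) * (1 + h) * ρ := by
    have hsep : ∀ p ∈ Rim, ∀ q ∈ Rim, p ≠ q → 1 ≤ dist p q :=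
      fun p hp q hq hpq => hX p (mem_filter.1 hp).1 q (mem_filter.1 hq).1 hpq
    have hmem : ∀ p ∈ Rim, -(2 * R₀) ≤ p 2 ∧ p 2 ≤ h + 2 * R₀ ∧ (ρ - 8) ^ 2 < p 0 ^ 2 + p 1 ^ 2 ∧
        p 0 ^ 2 + p 1 ^ 2 ≤ ρ ^ 2 := by
      intro p hp
      obtain ⟨hpX, hpr⟩ := mem_filter.1 hp
      obtain ⟨a, b, c'⟩ := hcell p hpX
      exact ⟨a, b, hpr, c'⟩
    have key := card_mul_le_of_separated_in_shell Rim hsep (-(2 * R₀)) (h + 2 * R₀) (ρ - 8) ρ (by linarith)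
      (by linarith) (by linarith) hmem
    have e : (h + 2 * R₀ - -(2 * R₀) + 2) * (Real.pi * (ρ + 1) ^ 2 - Real.pi * (ρ - 8 - 1) ^ 2) =
        (Real.pi / 6) * (6 * (h + 4 * R₀ + 2) * (20 * ρ - 80)) := by ring
    rw [e] at key
    have hπ : 0 < Real.pi / 6 := by positivity
    have h1 : (Rim.card : ℝ) ≤ 6 * (h + 4 * R₀ + 2) * (20 * ρ - 80) := le_of_mul_le_mul_right
      (by linarith [key]) hπ
    have h2 : h + 4 * R₀ + 2 ≤ (4 * R₀ + 2) * (1 + h) := by nlinarith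
    have h3 : 20 * ρ - 80 ≤ 20 * ρ := by linarith
    have h4 : (0 : ℝ) ≤ h + 4 * R₀ + 2 := by linarith
    nlinarith
  -- (6) pointwise and sum
  have hpt : ∀ x ∈ X, (k x : ℝ) - 25 * (if (ρ - 8) ^ 2 < x 0 ^ 2 + x 1 ^ 2 then 1 else 0) ≤
      12 - (deg x : ℝ) := by
    intro x hx
    split_ifs with hr
    · have h1 : (k x : ℝ) ≤ 25 := by exact_mod_cast hk25 x
      have h2 : (deg x : ℝ) ≤ 12 := by exact_mod_cast hdeg12 x
      linarith
    · have := hk_le x hx hr; simpa using this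
  have hsum := Finset.sum_le_sum hpt
  rw [sum_sub_distrib, ← mul_sum, sum_boole] at hsum
  rw [hk_sum] at hsum
  have hDeg : ∑ x ∈ X, ((12 : ℝ) - ((X.filter fun q => dist x q = 1).card : ℝ)) =
      ∑ x ∈ X, ((12 : ℝ) - (deg x : ℝ)) := rfl
  rw [hDeg]
  have hRimdef : (X.filter fun x => (ρ - 8) ^ 2 < x 0 ^ 2 + x 1 ^ 2) = Rim := rfl
  rw [hRimdef] at hsum
  have hpos : 0 ≤ Real.sqrt 2 * Real.pi * h * ρ := by positivity
  linarith [hOut₁, hOut₂, hsum, hPAY'ge, hRim]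

end Summit.Ventures.Crystal3D.Theorems

end
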